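import Summits.BirchSwinnertonDyer.BirchSwinnertonDyer.Theorems.KolyvaginRoadThreeMethod2OrdinaryLocalDefs
import Summits.BirchSwinnertonDyer.BirchSwinnertonDyer.Theorems.KolyvaginRoadThreeMethod2IsoOrdinary
import Summits.BirchSwinnertonDyer.BirchSwinnertonDyer.Theorems.KolyvaginRoadThreeMethod2LocalH0
import Summits.BirchSwinnertonDyer.BirchSwinnertonDyer.Theorems.KolyvaginRoadThreeMethod2Defs
import Summits.BirchSwinnertonDyer.Rank1Residual.X11b.KummerPoitouTateExact
import Literature.NumberTheory.GaloisCohomology.PoitouTateSumTotallyComplex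
import HarnessLib

/-!
# Route `KolyvaginRoadThree`, deciding crux `ZhangSharpFrameAtThreeHL` (item stmt-BirchSwinnertonDyer-19574):
# (Lag-ord) part 1 — the genuine ordinary condition `Method2.ordinaryLocalCondition`: dictionary with
# `ordinaryLocalKer`, isotropy for the local Weil cup product, and the upper count `#L · #L ≤ #H¹`
# (cell `bsd-stepL`, ACCEL seat `bsd-stepL-koly3b` g6; `--supports stmt-BirchSwinnertonDyer-19574`, helper; part XIX of the
# `KolyvaginRoadThreeZhangSupply*` series)

HONEST FRAMING. Theorems only; 0 definitions, 0 named facts, 0 `sorry`; closes nothing (T7). PARTITION: O2@3 (B10) × A1 ×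
crux 19574 × the S2-ENGINE's (Supply) binder — proves-glue ∕ types-the-object-of.

WHAT. Part XVIII (`hjump_of_localLagrangians`, p517552) reduced the (J) binder `hjump` of S2-ENGINE's (Supply) to the named
PT fact and two LOCAL inputs; (Lag-ord) asks above every good unipotent-admissible prime `q` for a local condition
`Lord v ≤ H¹(K_v, E[3])` with three clauses `hordIso` ∕ `hordCard` ∕ `hordIncl`. With `Lord v :=
Method2.ordinaryLocalCondition (E/K) K_v 3` (p519040: the classes with a `Γ_{K_v}`-invariant-valued cocycle
representative) this file proves:
* §1 the DICTIONARY `x ∈ ordinaryLocalKer_v ⟺ res_v x ∈ ordinaryLocalCondition` (koly g13's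
  `Iso.exists_invariant_cocycle_of_mem_ordinaryLocalKer` is `⟹`; `⟸` transports the invariant-valued representative along
  the torsion comparison `θ : E[n](K̄) ≃ E(K̄_v)[n]`) — whence the clause `hordIncl` (`hordIncl_ordinaryLocalCondition`);
* §2 ISOTROPY for the local Weil cup product of every Weil-type pairing, in LOCAL form (the cochain computation of koly g13's
  `Iso.weilCupProduct_res_eq_zero_of_mem_ordinaryLocalKer` on local classes) — whence the clause `hordIso` above a GOOD
  unipotent-admissible prime (`h⁰ ≤ 1` there: `Iso.natCard_invariants_le_three_of_frobSqNeOneAt`, and `e(L₀, L₀) = 0` on the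
  toric line: `Iso.weilPairingHom_eq_zero_of_invariant_of_card_le`);
* §3 the UPPER COUNT `#L · #L ≤ #H¹(K_v, E[3])` for any isotropic local condition at a finite place (isotropy `L ≤ L^⊥` for
  the local Tate pairing of the Poitou–Tate family of the totally complex `K` — tree THEOREM
  `poitouTate_sum_localTatePairing_eq_zero_of_isTotallyComplex` — and `#L^⊥ · #L = #H¹`, X11b `natCard_annRight_mul`).
The EQUALITY `hordCard` (a non-zero ordinary class from a ramified Kummer character) is the companion part XX
(`KolyvaginRoadThreeZhangSupplyOrdinaryWitness.lean`).

References: [cite: BertoliniDarmon2005, §2.2–§2.3 (H¹_ord)] [cite: WZhang2014, §4.1, Prop. 5.4] [cite: MilneADT2006, Ch. I,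
Cor. 2.3, Thm. 2.8] [cite: PoonenRains2012, Prop. 4.10] [cite: SilvermanAEC2009, Cor. III.6.4(b), Prop. III.8.1].
-/

noncomputable section

open scoped Classical

universe u

namespace Summit.BirchSwinnertonDyer.Rank1Residual.X11b.Three.Koly.ZhangSupply

open CategoryTheory WeierstrassCurve Field Function NumberField IsDedekindDomain
open Literature.NumberTheory.EllipticCurves Literature.NumberTheory.GaloisRepresentations
open Literature.NumberTheory.GaloisRepresentations.DiscreteGaloisModule (mu MuCarrier)
open Summit.BirchSwinnertonDyer.Rank1Residual.X11b.Three.Koly.Method2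
open Summit.BirchSwinnertonDyer.Rank1Residual.X11b.FiniteDuality
open Summit.BirchSwinnertonDyer.Rank1Residual.X11b.Relaxation
open Summit.BirchSwinnertonDyer.Rank1Residual.GaloisImage
open Literature.NumberTheory.GaloisCohomology
open scoped ContRepresentation

-- Cup products need `LocallyCompactSpace Γ`; `E[n]` finite: local instances (as in the tree's cup-product files).
attribute [local instance] absoluteGaloisGroup_compactSpace
attribute [local instance] finite_geomTorsion_of_neZero

/-! ## §1 The dictionary with the global-currency `ordinaryLocalKer` (both directions) -/

section Dictionary

variable {K : Type u} [Field K] [NumberField K] (E : WeierstrassCurve K) (n : ℕ) [NeZero n] [E.IsElliptic]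
variable (L : Type u) [Field L] [Algebra K L]

/-- **`res_L x ∈ ordinaryLocalCondition ⟹ x ∈ ordinaryLocalKer`** (the converse of koly g13's
`Iso.exists_invariant_cocycle_of_mem_ordinaryLocalKer`): if the restriction of `x = [φ]` is the class of an
invariant-valued cocycle `ψ`, `φ ∘ res − ψ = ∂m`, then the localisation `torsionLocMap x = [θ ∘ φ ∘ res]` is the class of
the fixed-point-valued cocycle `θ ∘ ψ` (`θ = torsionPointsEquiv`, equivariant), the difference being `∂(θ m)`.
[cite: BertoliniDarmon2005, §2.2 (H¹_ord)] [cite: SilvermanAEC2009, Cor. III.6.4(b)] -/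
theorem mem_ordinaryLocalKer_of_res_mem_ordinaryLocalCondition {x : galH1Torsion E (n : ℤ)}
    (hx : galoisCohomology.res (E.torsionGaloisModule n) L 1 x ∈ ordinaryLocalCondition E L (n : ℤ)) :
    x ∈ E.ordinaryLocalKer L (n : ℤ) := by
  have hn : (n : ℤ) ≠ 0 := by exact_mod_cast NeZero.ne n
  obtain ⟨φ, rfl⟩ := oneCocycleClass_surjective (discreteTopRep (absoluteGaloisGroup K) (geomTorsion E n)) x
  obtain ⟨ψ, hψinv, hψ⟩ := hx
  -- `ψ - φ ∘ res = ∂ m`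
  rw [res_torsionGaloisModule_oneCocycleClass, ← sub_eq_zero, ← oneCocycleClass_sub, oneCocycleClass_eq_zero_iff]
    at hψ
  obtain ⟨m, hm⟩ := hψ
  have hm' : ∀ σ : absoluteGaloisGroup L, ψ.1 σ - φ.1 (absGaloisRestrict K L σ) = absGaloisRestrict K L σ • m - m :=
    fun σ ↦ hm σ
  set θ := E.torsionPointsEquiv (n : ℤ) (E := L) hn with hθ
  -- the fixed-point-valued local cocycle `θ ∘ ψ`
  have hcoc : ∀ g h : absoluteGaloisGroup L, ψ.1 (g * h) = ψ.1 g + absGaloisRestrict K L g • ψ.1 h :=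
    fun g h ↦ ψ.2 g h
  let ψ' : contOneCocycles (discreteTopRep (absoluteGaloisGroup L)
      (AddSubgroup.torsionBy (localPoints E L) (n : ℤ))) :=
    ⟨⟨fun σ ↦ θ (ψ.1 σ), continuous_of_discreteTopology.comp ψ.1.continuous⟩, fun g h ↦ by
      change θ (ψ.1 (g * h)) = θ (ψ.1 g) + g • θ (ψ.1 h)
      rw [hcoc g h, map_add, hθ, ← torsionPointsEquiv_smul, resGal_eq_absGaloisRestrict]⟩
  have hψ' : ∀ σ, ψ'.1 σ = θ (ψ.1 σ) := fun σ ↦ rfl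
  -- unfold the ordinary kernel
  change oneCocycleClass _ φ ∈ AddSubgroup.comap _ _
  rw [AddSubgroup.mem_comap]
  refine ⟨ψ', fun σ ↦ ?_, ?_⟩
  · -- values are fixed points
    rw [FixedPoints.mem_addSubgroup]  -- may need the right lemma name
    intro τ
    rw [hψ', hθ, ← torsionPointsEquiv_smul, resGal_eq_absGaloisRestrict, hψinv σ τ]
  · -- the class: `torsionLocMap [φ] = [θ ∘ φ ∘ res] = [ψ']`
    have hloc : E.torsionLocMap L (n : ℤ)
          (oneCocycleClass (discreteTopRep (absoluteGaloisGroup K) (geomTorsion E n)) φ) =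
        oneCocycleClass (discreteTopRep (absoluteGaloisGroup L)
            (AddSubgroup.torsionBy (localPoints E L) (n : ℤ)))
          (contOneCocycles.pullback (resGal (K := K) L)
            (resHomOfEquivariant (resGal (K := K) L)
              (torsionPointsMap E L n) (torsionPointsMap_smul E L n)) φ) :=
      map_oneCocycleClass _ _ _ φ
    rw [hloc, ← sub_eq_zero, ← oneCocycleClass_sub, oneCocycleClass_eq_zero_iff]
    refine ⟨θ m, fun g ↦ ?_⟩
    change θ (ψ.1 g) - torsionPointsMap E L n (φ.1 (resGal (K := K) L g)) = g • θ m - θ m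
    rw [resGal_eq_absGaloisRestrict, hθ, ← torsionPointsEquiv_apply E (n : ℤ) hn, ← map_sub, hm',
      map_sub, ← resGal_eq_absGaloisRestrict, torsionPointsEquiv_smul]

/-- **`x ∈ ordinaryLocalKer ⟺ res_L x ∈ ordinaryLocalCondition`** (koly g13's forward direction + the converse above).
[cite: BertoliniDarmon2005, §2.2 (H¹_ord)] -/
theorem mem_ordinaryLocalKer_iff_res_mem_ordinaryLocalCondition (x : galH1Torsion E (n : ℤ)) :
    x ∈ E.ordinaryLocalKer L (n : ℤ) ↔
      galoisCohomology.res (E.torsionGaloisModule n) L 1 x ∈ ordinaryLocalCondition E L (n : ℤ) := by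
  refine ⟨fun hx ↦ ?_, mem_ordinaryLocalKer_of_res_mem_ordinaryLocalCondition E n L⟩
  obtain ⟨ψ, hψ, h⟩ := Iso.exists_invariant_cocycle_of_mem_ordinaryLocalKer E n L hx
  exact ⟨ψ, hψ, h⟩

end Dictionary

/-! ## §2 Isotropy of the genuine ordinary condition for the local Weil cup product -/

section Isotropy

variable {K : Type u} [Field K] (E : WeierstrassCurve K) (n : ℕ) [NeZero n]
variable (L : Type u) [Field L] [Algebra K L]
variable (e : geomTorsion E n → geomTorsion E n → AlgebraicClosure K)
  (hμ : ∀ S T, e S T ^ n = 1)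
  (hadd₁ : ∀ S₁ S₂ T, e (S₁ + S₂) T = e S₁ T * e S₂ T)
  (hadd₂ : ∀ S T₁ T₂, e S (T₁ + T₂) = e S T₁ * e S T₂)
  (hgal : ∀ (σ : absoluteGaloisGroup K) (S T : geomTorsion E n), σ • e S T = e (σ • S) (σ • T))

/-- **Two classes of the genuine ordinary condition have vanishing local Weil cup product when `e(L₀, L₀) = 0`** —
the LOCAL form of koly g13's `Iso.weilCupProduct_res_eq_zero_of_mem_ordinaryLocalKer` (same cochain computation: on
invariant-valued representatives the cup-product `2`-cochain `(a,b,c) ↦ e(ψ b − ψ a, χ c − χ b)` vanishes identically).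
[cite: WZhang2014, §4.1, Prop. 5.4] [cite: BertoliniDarmon2005, §2.3] -/
theorem cupProduct_eq_zero_of_mem_ordinaryLocalCondition
    (hinv : ∀ S T : geomTorsion E n, (∀ τ : absoluteGaloisGroup L, absGaloisRestrict K L τ • S = S) →
      (∀ τ : absoluteGaloisGroup L, absGaloisRestrict K L τ • T = T) → weilPairingHom E n e hμ hadd₁ hadd₂ S T = 0)
    {a b : galoisCohomology (GaloisRep.restrictField L (E.torsionGaloisModule n)) 1}
    (ha : a ∈ ordinaryLocalCondition E L (n : ℤ)) (hb : b ∈ ordinaryLocalCondition E L (n : ℤ)) :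
    ((weilContPairing E n e hμ hadd₁ hadd₂ hgal).restrict (absGaloisRestrict K L)).cupProduct a b = 0 := by
  obtain ⟨ψy, hψy, rfl⟩ := ha
  obtain ⟨ψz, hψz, rfl⟩ := hb
  erw [ContPairing.cupProduct_oneCocycleClass]
  have hcoch : ((weilContPairing E n e hμ hadd₁ hadd₂ hgal).restrict (absGaloisRestrict K L)).cupTwoCochain ψy ψz =
      ((weilContPairing E n e hμ hadd₁ hadd₂ hgal).restrict (absGaloisRestrict K L)).cupTwoCochain 0 ψz := by
    apply Subtype.ext
    refine ContinuousMap.ext fun a => ContinuousMap.ext fun b => ContinuousMap.ext fun c => ?_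
    rw [ContPairing.cupTwoCochain_apply, ContPairing.cupTwoCochain_apply]
    change weilPairingHom E n e hμ hadd₁ hadd₂ (ψy.1 b - ψy.1 a) (ψz.1 c - ψz.1 b) =
      weilPairingHom E n e hμ hadd₁ hadd₂ ((0 : contOneCocycles _).1 b - (0 : contOneCocycles _).1 a)
        (ψz.1 c - ψz.1 b)
    have h0 : ∀ g : absoluteGaloisGroup L, (0 : contOneCocycles (TopRep.res
        (absGaloisRestrict K L : absoluteGaloisGroup L →* absoluteGaloisGroup K)
        (E.torsionGaloisModule n).toTopRep)).1 g = 0 := fun g => rfl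
    rw [h0, h0, sub_zero, map_zero, AddMonoidHom.zero_apply,
      hinv _ _ (fun τ => by rw [smul_sub, hψy, hψy]) (fun τ => by rw [smul_sub, hψz, hψz])]
  unfold ContPairing.cupClass
  rw [cxClass_congr hcoch]
  exact ContPairing.cupClass_eq_zero_of_left _ 0 ψz (oneCocycleClass_zero _)

end Isotropy

/-! ## §3 At the place of a good unipotent-admissible prime of the Hoffstein–Luo frame -/

section Frame

variable (W : WeierstrassCurve ℚ) (K : Type) [Field K] [NumberField K] [W.IsElliptic] [W.IsGloballyMinimal]

omit [W.IsGloballyMinimal] in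
/-- **(Lag-ord), dictionary clause `hordIncl`** of `hjump_of_localLagrangians` for
`Lord v := ordinaryLocalCondition (W/K) K_v 3`: `loc_v x ∈ Lord v ⟹ x ∈ ordinaryLocalKer_v`.
[cite: BertoliniDarmon2005, §2.2 (H¹_ord)] -/
theorem hordIncl_ordinaryLocalCondition (v : HeightOneSpectrum (𝓞 K)) (x : V3 W K)
    (hx : galoisCohomology.localization ((W.baseChange K).torsionGaloisModule ((3 ^ 1 : ℕ) : ℤ)) (Sum.inr v) 1 x ∈
      ordinaryLocalCondition (W.baseChange K) (v.adicCompletion K) ((3 ^ 1 : ℕ) : ℤ)) :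
    x ∈ (W.baseChange K).ordinaryLocalKer (v.adicCompletion K) ((3 ^ 1 : ℕ) : ℤ) :=
  haveI : NeZero (3 ^ 1 : ℕ) := ⟨by norm_num⟩
  mem_ordinaryLocalKer_of_res_mem_ordinaryLocalCondition (W.baseChange K) (3 ^ 1) (v.adicCompletion K) hx

/-- **(Lag-ord), isotropy clause `hordIso`** of `hjump_of_localLagrangians` for `Lord v := ordinaryLocalCondition`:
above a GOOD unipotent-admissible prime (`FrobSqNeOneAt`: `h⁰(K_v, E[3]) ≤ 1`, koly g13
`Iso.natCard_invariants_le_three_of_frobSqNeOneAt`) the genuine ordinary condition is isotropic for the local Weil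
cup product of every alternating Weil-type pairing (`e(L₀, L₀) = 0` on the toric line).
[cite: WZhang2014, §4.1, Prop. 5.4] [cite: BertoliniDarmon2005, §2.2–§2.3] -/
theorem hordIso_ordinaryLocalCondition (hK : IsImaginaryQuadratic K)
    (q : {q // IsUAdmissiblePrime W K q}) (hq : FrobSqNeOneAt W 3 q.1)
    (v : HeightOneSpectrum (𝓞 K)) (hqv : ((q : ℕ) : 𝓞 K) ∈ v.asIdeal)
    (e : geomTorsion (W.baseChange K) ((3 ^ 1 : ℕ) : ℤ) → geomTorsion (W.baseChange K) ((3 ^ 1 : ℕ) : ℤ) →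
      AlgebraicClosure K)
    (hμ : ∀ P Q, e P Q ^ (3 ^ 1) = 1) (hadd₁ : ∀ P₁ P₂ Q, e (P₁ + P₂) Q = e P₁ Q * e P₂ Q)
    (hadd₂ : ∀ P Q₁ Q₂, e P (Q₁ + Q₂) = e P Q₁ * e P Q₂) (halt : ∀ Q, e Q Q = 1)
    (hgal : ∀ (σ : absoluteGaloisGroup K) (P Q : geomTorsion (W.baseChange K) ((3 ^ 1 : ℕ) : ℤ)),
      σ • e P Q = e (σ • P) (σ • Q)) :
    ∀ a ∈ ordinaryLocalCondition (W.baseChange K) (v.adicCompletion K) ((3 ^ 1 : ℕ) : ℤ),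
    ∀ b ∈ ordinaryLocalCondition (W.baseChange K) (v.adicCompletion K) ((3 ^ 1 : ℕ) : ℤ),
      (weilContPairingLocal (W.baseChange K) (3 ^ 1) e hμ hadd₁ hadd₂ hgal (Sum.inr v)).cupProduct a b = 0 := by
  intro a ha b hb
  haveI : Fact (Nat.Prime (3 ^ 1)) := ⟨by norm_num⟩
  haveI : NeZero (3 ^ 1 : ℕ) := ⟨by norm_num⟩
  have hH0 := Iso.natCard_invariants_le_three_of_frobSqNeOneAt W K hK q hq v hqv
  exact cupProduct_eq_zero_of_mem_ordinaryLocalCondition (W.baseChange K) (3 ^ 1) (v.adicCompletion K) e hμ hadd₁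
    hadd₂ hgal (Iso.weilPairingHom_eq_zero_of_invariant_of_card_le (W.baseChange K) (3 ^ 1) (v.adicCompletion K) e
      hμ hadd₁ hadd₂ halt hH0) ha hb

omit [W.IsGloballyMinimal] in
/-- **(Lag-ord), the upper count**: an isotropic local condition at a finite place has `#L · #L ≤ #H¹(K_v, E[3])`
(isotropy `L ≤ L^⊥` for the local Tate pairing of a Poitou–Tate family — tree THEOREM
`poitouTate_sum_localTatePairing_eq_zero_of_isTotallyComplex` — and `#L^⊥ · #L = #H¹`). Hence, above a good
unipotent-admissible prime, `#Lord v · #Lord v ≤ #H¹(K_v, E[3])`. [cite: MilneADT2006, Ch. I, Cor. 2.3]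
[cite: PoonenRains2012, Prop. 4.10] -/
theorem natCard_mul_natCard_le_of_isotropic (hK : IsImaginaryQuadratic K) (v : HeightOneSpectrum (𝓞 K))
    (Lv : AddSubgroup (galoisCohomology (((W.baseChange K).torsionGaloisModule ((3 ^ 1 : ℕ) : ℤ)).toLocal
      (Sum.inr v)) 1))
    (hiso : ∀ (e : geomTorsion (W.baseChange K) ((3 ^ 1 : ℕ) : ℤ) → geomTorsion (W.baseChange K) ((3 ^ 1 : ℕ) : ℤ) →
          AlgebraicClosure K)
        (hμ : ∀ P Q, e P Q ^ (3 ^ 1) = 1) (hadd₁ : ∀ P₁ P₂ Q, e (P₁ + P₂) Q = e P₁ Q * e P₂ Q)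
        (hadd₂ : ∀ P Q₁ Q₂, e P (Q₁ + Q₂) = e P Q₁ * e P Q₂) (_halt : ∀ Q, e Q Q = 1)
        (_hnondeg : ∀ Q, (∀ P, e P Q = 1) → Q = 0)
        (hgal : ∀ (σ : absoluteGaloisGroup K) (P Q : geomTorsion (W.baseChange K) ((3 ^ 1 : ℕ) : ℤ)),
          σ • e P Q = e (σ • P) (σ • Q)),
      ∀ a ∈ Lv, ∀ b ∈ Lv, (weilContPairingLocal (W.baseChange K) (3 ^ 1) e hμ hadd₁ hadd₂ hgal (Sum.inr v)).cupProduct a b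
        = 0) :
    Nat.card Lv * Nat.card Lv ≤
      Nat.card (galoisCohomology (((W.baseChange K).torsionGaloisModule ((3 ^ 1 : ℕ) : ℤ)).toLocal (Sum.inr v)) 1) := by
  haveI : IsTotallyComplex K := hK.2
  haveI : NeZero (3 ^ 1 : ℕ) := ⟨by norm_num⟩
  haveI := KummerPT.finite_galoisCohomology_toLocal_inr (W.baseChange K) (3 ^ 1) v
  obtain ⟨e, hμ, hadd₁, hadd₂, halt, hnondeg, hgal⟩ :=
    exists_weilPairing_holds (W.baseChange K) (3 ^ 1) (by norm_num) (by norm_num)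
  obtain ⟨inv, hinvperf, -⟩ := poitouTate_sum_localTatePairing_eq_zero_of_isTotallyComplex K (3 ^ 1)
  have hinj : Injective (inv (Sum.inr v)) := (hinvperf v).1.1
  set b := invWeilPairing (W.baseChange K) (3 ^ 1) e hμ hadd₁ hadd₂ hgal inv (Sum.inr v) with hb
  have hA := KummerPT.nsmul_galoisCohomology_toLocal_eq_zero (W.baseChange K) (3 ^ 1) (Sum.inr v)
  have hle : Lv ≤ annRight b Lv := fun y hy ↦ (mem_annRight_iff b Lv y).mpr fun x hx ↦ by
    rw [hb, invWeilPairing_apply, hiso e hμ hadd₁ hadd₂ halt hnondeg hgal x hx y hy]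
    exact map_zero _
  have hmul : Nat.card (annRight b Lv) * Nat.card Lv =
      Nat.card (galoisCohomology (((W.baseChange K).torsionGaloisModule ((3 ^ 1 : ℕ) : ℤ)).toLocal (Sum.inr v)) 1) :=
    natCard_annRight_mul hA b (KummerPT.invWeilPairing_flip_bijective (W.baseChange K) (3 ^ 1) e hμ hadd₁ hadd₂ hgal
      hnondeg inv v hinj) Lv
  calc Nat.card Lv * Nat.card Lv ≤ Nat.card (annRight b Lv) * Nat.card Lv :=
        Nat.mul_le_mul_right _ (AddSubgroup.card_le_of_le hle)
    _ = _ := hmul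

end Frame

end Summit.BirchSwinnertonDyer.Rank1Residual.X11b.Three.Koly.ZhangSupply


end
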